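import Literature.Probability.LatticeModels.FKIsingBarObservable
import Literature.Probability.LatticeModels.BoxSineHarmonic
import HarnessLib

/-!
# The harmonic-measure lower bound in the bar domain: `P(x ↔ bar)² ≥ κ/(W+1)²`

Topic `Literature/Probability/LatticeModels`; the potential-theoretic half of
Duminil-Copin–Hongler–Nolin's Proposition 13 (arXiv:0912.4253 §4: "the harmonic measure of the
wired point seen from `x` is of order `1/n²`"), in the bar domain `LatticeDobrushin.barDomain W N c`
and for the exact discrete primitive of the tree (`IsFKPrimitive`). Everything is PROVED
(0 new facts).

* `latticeLaplacian_comp_add`, `latticeLaplacian_const_sub`: bookkeeping for the Laplacian.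
* **`levelB_sub_hb_ge`**: `H_B - Hb(x₁, 0) ≥ 3 e^{-4π} γ₀/(W+1)²`, `γ₀ = (1-τ)/(4-τ)`,
  `τ = (√2-1)²`, for `W ≥ 40`, `7(W+1) ≤ 2(N+1) ≤ 8(W+1)`, the bar and the column `x₁` in the
  middle half: `g = H_B - Hb` is superharmonic on the faces of `R` (`subharmonicOn_interiorFaces`),
  `≥ 0` on the faces around `R` (`hb_le_levelB`), `≥ γ₀` on the three window faces
  (`window_source`), hence `g ≥ ψ` for the sine-series solution `ψ = boxSine W N (windowData γ₀ (c+1))`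
  shifted by `(1,1)` (`le_of_sub_super_of_boundary`), and `ψ(x₁+1, 1)` is bounded below by
  `boxSine_window_lower_bound`.
* **`openJoined_sq_ge`**, **`bar_openJoined_sq_ge`** (primitive-free, via `exists_isFKPrimitive`):
  the same constant bounds `P(x ↔ bar by open edges)²` under the FK Dobrushin measure of the bar
  domain (`levelB_sub_hb_le_dartFlux`, `dartFlux_le_openJoined_sq`).

## References

* H. Duminil-Copin, C. Hongler, P. Nolin, *Connection probabilities and RSW-type bounds for the
  two-dimensional FK Ising model*, Comm. Pure Appl. Math. 64 (2011), §3.2 (Lemma 9, Lemma 12),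
  §4 (Proposition 13) — bib key `DuminilCopinHonglerNolin2011`.
* S. Smirnov, *Conformal invariance in random cluster models. I*, Ann. Math. 172 (2010), §3–§4.
-/

namespace Literature.Probability.LatticeModels

open Finset Set SimpleGraph _root_.Real

namespace LatticeDobrushin

variable {W N : ℕ} {c : ℤ}

/-! ### Comparison with the sine-series barrier: `H_B - Hb ≥ κ/(W+1)²` on the bottom row -/

/-- Translating the argument commutes with the lattice Laplacian. [folklore] -/
theorem latticeLaplacian_comp_add (f : Site 2 → ℝ) (w v : Site 2) :
    latticeLaplacian (fun u => f (u + w)) v = latticeLaplacian f (v + w) := by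
  simp only [latticeLaplacian, add_right_comm]

/-- The Laplacian of `β - H` is minus that of `H`. [folklore] -/
theorem latticeLaplacian_const_sub (β : ℝ) (H : Site 2 → ℝ) (v : Site 2) :
    latticeLaplacian (fun u => β - H u) v = -latticeLaplacian H v := by
  simp only [latticeLaplacian, ← Finset.sum_neg_distrib]
  exact Finset.sum_congr rfl fun k _ => by ring

section Comparison

variable (hc : 0 ≤ c) (hcW : c + 3 ≤ W) {Hw Hb : Site 2 → ℝ}
  (h : IsFKPrimitive (barDomain W N c).toDobrushin (isZdAdmissible_barDomain hc hcW) Hw Hb)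
include h

local notation "c₀" => DiscreteDobrushin.startCorner (isZdAdmissible_barDomain (W := W) (N := N) (c := c) hc hcW)

/-- **The harmonic-measure lower bound for the primitive** (DCHN Proposition 13, the potential
theoretic core). In the bar domain of width `W ≥ 40` and height `N` with `7(W+1) ≤ 2(N+1) ≤ 8(W+1)`,
with the bar `[c, c+3] × {N+1}` in the middle half, at every face `(x₁, 0)` of the bottom row of
`R` in the middle half, `H_B - Hb(x₁, 0) ≥ 3 e^{-4π} γ₀ /(W+1)²`, `γ₀ = (1-τ)/(4-τ)`,
`τ = (√2-1)²`: `H_B - Hb` is superharmonic on the faces of `R` (Lemma 3.8), nonnegative on the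
faces around `R` (`Hb ≤ H_B`), at least `γ₀` on the three window faces under the bar
(`window_source`), hence above the sine-series solution `boxSine` of the box Dirichlet problem with
these data (`le_of_sub_super_of_boundary`), which is bounded below by
`boxSine_window_lower_bound`. [cite: DuminilCopinHonglerNolin2011, §4, Proposition 13] -/
theorem levelB_sub_hb_ge (hW : 40 ≤ W) (hN : 7 * (W + 1) ≤ 2 * (N + 1)) (hN' : N + 1 ≤ 4 * (W + 1))
    (hcl : ((W : ℝ) + 1) / 4 ≤ (c : ℝ) + 1) (hcu : (c : ℝ) + 3 ≤ 3 * ((W : ℝ) + 1) / 4)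
    {x₁ : ℤ} (hx₁ : ((W : ℝ) + 1) / 4 ≤ (x₁ : ℝ) + 1) (hx₁' : (x₁ : ℝ) + 1 ≤ 3 * ((W : ℝ) + 1) / 4) :
    3 * Real.exp (-(4 * π)) * ((1 - (Real.sqrt 2 - 1) ^ 2) / (4 - (Real.sqrt 2 - 1) ^ 2)) / ((W : ℝ) + 1) ^ 2 ≤
      Hw ((c₀).1 + cornerUnit (c₀).2) - Hb ![x₁, 0] := by
  have hWr : (40 : ℝ) ≤ W := by exact_mod_cast hW
  -- integrality consequences of the real hypotheses
  have hx0 : 0 ≤ x₁ := by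
    have : (0 : ℝ) ≤ x₁ := by linarith
    exact_mod_cast this
  have hxW : x₁ + 1 ≤ W := by
    have : (x₁ : ℝ) + 1 ≤ W := by linarith
    exact_mod_cast this
  have hN1 : 1 ≤ N := by omega
  set τ : ℝ := (Real.sqrt 2 - 1) ^ 2 with hτ
  have hτ1 : τ < 1 := by
    have h1 : Real.sqrt 2 < 2 := by
      rw [show (2 : ℝ) = Real.sqrt 4 by rw [show (4 : ℝ) = 2 ^ 2 by norm_num, Real.sqrt_sq (by norm_num)]]
      exact Real.sqrt_lt_sqrt (by norm_num) (by norm_num)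
    have h2 : 1 < Real.sqrt 2 := by
      rw [show (1 : ℝ) = Real.sqrt 1 by simp]
      exact Real.sqrt_lt_sqrt (by norm_num) (by norm_num)
    rw [hτ]; nlinarith
  set γ₀ : ℝ := (1 - τ) / (4 - τ) with hγ₀
  have hγ₀0 : 0 ≤ γ₀ := div_nonneg (by linarith) (by linarith)
  set β := Hw ((c₀).1 + cornerUnit (c₀).2) with hβ
  -- the two functions and the comparison set
  set ψ : Site 2 → ℝ := fun v => boxSine W N (windowData γ₀ (c + 1)) (v + ![1, 1]) with hψ
  set g : Site 2 → ℝ := fun F => β - Hb F with hg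
  set T : Set (Site 2) := {F | 0 ≤ F 0 ∧ F 0 + 1 ≤ (W : ℤ) ∧ 0 ≤ F 1 ∧ F 1 + 1 ≤ (N : ℤ)} with hT
  have hTfin : T.Finite := by
    refine (boxSites_finite ![0, 0] ![(W : ℤ), (N : ℤ)]).subset ?_
    intro F hF
    simp only [hT, Set.mem_setOf_eq] at hF
    intro i; fin_cases i <;> simp <;> omega
  have h₁ : IsLatticeSubharmonicOn ψ T := by
    intro v _
    rw [hψ, latticeLaplacian_comp_add, latticeLaplacian_boxSine]
  have hA := preconnected_zdArcA_barDomain (N := N) hc hcW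
  have h₂ : IsLatticeSuperharmonicOn g T := by
    intro F hF
    rw [hg, latticeLaplacian_const_sub, neg_nonpos]
    exact h.subharmonicOn_interiorFaces hA F (mem_interiorFaces_barDomain hc hcW hF)
  -- boundary comparison
  have hb : ∀ w ∈ latticeOuterBoundary T, ψ w ≤ g w + 0 := by
    rintro w ⟨hwT, v, hv, k, rfl⟩
    simp only [hT, Set.mem_setOf_eq, not_and, not_le] at hv hwT
    rw [add_zero]
    -- `g ≥ 0` at every inner face
    have g_nonneg : ∀ F : Site 2, (barDomain W N c).toDobrushin.IsInnerFace F → 0 ≤ g F := fun F hF => by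
      have := hb_le_levelB hc hcW h hF; rw [hg]; linarith
    fin_cases k
    · -- right: `w 0 = W`
      show ψ (v + cornerUnit 0) ≤ g (v + cornerUnit 0)
      have hw0 : v 0 + 1 = W := by
        simp [cornerUnit] at hwT; omega
      have hψ0 : ψ (v + cornerUnit 0) = 0 := by
        apply boxSine_right
        simp [cornerUnit]; omega
      rw [hψ0]
      exact g_nonneg _ (isInnerFace_barDomain_iff.2 (by simp [cornerUnit]; omega))
    · -- top: `w 1 = N`, data row
      show ψ (v + cornerUnit 1) ≤ g (v + cornerUnit 1)
      have hw1 : v 1 + 1 = N := by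
        simp [cornerUnit] at hwT; omega
      have hψ1 : ψ (v + cornerUnit 1) = windowData γ₀ (c + 1) (v 0 + 1) := by
        have := boxSine_top W N (windowData γ₀ (c + 1)) (v + cornerUnit 1 + (![1, 1] : Site 2))
          (by simp [cornerUnit]; omega) (by simp [cornerUnit]; omega)
        rw [hψ]; simp only at this ⊢
        rw [this]; simp [cornerUnit]
      rw [hψ1, windowData]
      split_ifs with hwin
      · -- a window face
        have := window_source hc hcW h (F := v + cornerUnit 1) (by simp [cornerUnit]; omega) (by simp [cornerUnit]; omega)
        rw [hg]; exact this
      · exact g_nonneg _ (isInnerFace_barDomain_iff.2 (by simp [cornerUnit]; omega))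
    · -- left: `w 0 = -1`
      show ψ (v + cornerUnit 2) ≤ g (v + cornerUnit 2)
      have hw0 : v 0 = 0 := by
        simp [cornerUnit] at hwT; omega
      have hψ0 : ψ (v + cornerUnit 2) = 0 := by
        apply boxSine_left
        simp [cornerUnit]; omega
      rw [hψ0]
      exact g_nonneg _ (isInnerFace_barDomain_iff.2 (by simp [cornerUnit]; omega))
    · -- bottom: `w 1 = -1`
      show ψ (v + cornerUnit 3) ≤ g (v + cornerUnit 3)
      have hw1 : v 1 = 0 := by
        simp [cornerUnit] at hwT; omega
      have hψ0 : ψ (v + cornerUnit 3) = 0 := by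
        apply boxSine_bottom
        simp [cornerUnit]; omega
      rw [hψ0]
      exact g_nonneg _ (isInnerFace_barDomain_iff.2 (by simp [cornerUnit]; omega))
  have hcomp := le_of_sub_super_of_boundary hTfin h₁ h₂ hb ![x₁, 0] (by simp [hT]; omega)
  rw [add_zero] at hcomp
  -- the sine-series lower bound at `(x₁ + 1, 1)`
  have hlow := boxSine_window_lower_bound (M := N) hW hN hN' hγ₀0 (X₀ := c + 1) (X₁ := x₁ + 1)
    (by push_cast; linarith) (by push_cast; linarith) (by push_cast; linarith) (by push_cast; linarith)
  have e : ψ ![x₁, 0] = boxSine W N (windowData γ₀ (c + 1)) ![x₁ + 1, 1] := by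
    rw [hψ]; simp only
    congr 1; funext i; fin_cases i <;> simp
  rw [hg] at hcomp
  simp only at hcomp
  linarith [hlow, hcomp, e]

/-- **Corollary (DCHN Proposition 13 at the level of the bar domain)**: the flux across the
bottom dart at `x = (x₁, 0)`, hence the squared probability that `x` is joined to the bar by open
edges, is at least `κ/(W+1)²`. [cite: DuminilCopinHonglerNolin2011, §4, Proposition 13] -/
theorem openJoined_sq_ge (hW : 40 ≤ W) (hN : 7 * (W + 1) ≤ 2 * (N + 1)) (hN' : N + 1 ≤ 4 * (W + 1))
    (hcl : ((W : ℝ) + 1) / 4 ≤ (c : ℝ) + 1) (hcu : (c : ℝ) + 3 ≤ 3 * ((W : ℝ) + 1) / 4)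
    {x₁ : ℤ} (hx₁ : ((W : ℝ) + 1) / 4 ≤ (x₁ : ℝ) + 1) (hx₁' : (x₁ : ℝ) + 1 ≤ 3 * ((W : ℝ) + 1) / 4)
    (hx : (![x₁, 0] : Site 2) ∈ meshDomain (barDomain W N c).toDobrushin.Ω (barDomain W N c).toDobrushin.δ) :
    3 * Real.exp (-(4 * π)) * ((1 - (Real.sqrt 2 - 1) ^ 2) / (4 - (Real.sqrt 2 - 1) ^ 2)) / ((W : ℝ) + 1) ^ 2 ≤
      ((fkDobrushinMeasure (barDomain W N c).toDobrushin).real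
        {ω | (barDomain W N c).toDobrushin.OpenJoinedToArcA ⟨![x₁, 0], hx⟩ ω}) ^ 2 := by
  have hWr : (40 : ℝ) ≤ W := by exact_mod_cast hW
  have hx0 : 0 ≤ x₁ := by
    have : (0 : ℝ) ≤ x₁ := by linarith
    exact_mod_cast this
  have hxW : x₁ + 1 ≤ W := by
    have : (x₁ : ℝ) + 1 ≤ W := by linarith
    exact_mod_cast this
  have h1 := levelB_sub_hb_ge hc hcW h hW hN hN' hcl hcu hx₁ hx₁'
  have h2 := levelB_sub_hb_le_dartFlux hc hcW h (x := ![x₁, 0]) (by simp; omega) (by simp)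
  have hB : (![x₁, 0] : Site 2) + cornerUnit 3 ∈ (barDomain W N c).toDobrushin.zdArcB := by
    rw [zdArcB_barDomain hc hcW]
    refine ⟨mem_barDomain_S.2 ?_, ?_, ?_⟩ <;> simp [cornerUnit] <;> omega
  have h3 := DiscreteDobrushin.dartFlux_le_openJoined_sq (isZdAdmissible_barDomain (N := N) hc hcW) (![x₁, 0], 3) hB hx
  linarith

end Comparison

/-- **DCHN Proposition 13 in the bar domain, primitive-free form**: with the discrete primitive
supplied by `exists_isFKPrimitive` (hole-free inner faces, connected wired arc), the squared
probability, under the critical FK-Ising Dobrushin measure of the bar domain (wired on the bar,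
free on the rest of the ring), that the bottom-row site `(x₁, 0)` is joined to the bar by open
edges is at least `3 e^{-4π} γ₀/(W+1)²`. [cite: DuminilCopinHonglerNolin2011, §4, Proposition 13] -/
theorem bar_openJoined_sq_ge (hc : 0 ≤ c) (hcW : c + 3 ≤ W) (hW : 40 ≤ W) (hN : 7 * (W + 1) ≤ 2 * (N + 1))
    (hN' : N + 1 ≤ 4 * (W + 1)) (hcl : ((W : ℝ) + 1) / 4 ≤ (c : ℝ) + 1) (hcu : (c : ℝ) + 3 ≤ 3 * ((W : ℝ) + 1) / 4)
    {x₁ : ℤ} (hx₁ : ((W : ℝ) + 1) / 4 ≤ (x₁ : ℝ) + 1) (hx₁' : (x₁ : ℝ) + 1 ≤ 3 * ((W : ℝ) + 1) / 4)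
    (hx : (![x₁, 0] : Site 2) ∈ meshDomain (barDomain W N c).toDobrushin.Ω (barDomain W N c).toDobrushin.δ) :
    3 * Real.exp (-(4 * π)) * ((1 - (Real.sqrt 2 - 1) ^ 2) / (4 - (Real.sqrt 2 - 1) ^ 2)) / ((W : ℝ) + 1) ^ 2 ≤
      ((fkDobrushinMeasure (barDomain W N c).toDobrushin).real
        {ω | (barDomain W N c).toDobrushin.OpenJoinedToArcA ⟨![x₁, 0], hx⟩ ω}) ^ 2 := by
  obtain ⟨Hw, Hb, h⟩ := exists_isFKPrimitive (isZdAdmissible_barDomain (N := N) hc hcW)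
    (preconnected_zdArcA_barDomain hc hcW) (by exact holeFree_barDomain)
  exact openJoined_sq_ge hc hcW h hW hN hN' hcl hcu hx₁ hx₁' hx

end LatticeDobrushin

end Literature.Probability.LatticeModels
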